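/-
Copyright (c) 2026 the pub-hodgecm-mathlib formalisation cell (harness21).  Prover seat hodgecm-mathlib-F0P2-p07 (g0), strike line L1
`stub_firstTermThetaPairing` (LEAD F0P6-plan (g14) BATCH #68 «F0P2-p07 = non-split evaluation»; K2Liu-p26 (g2) 22:27:39Z (C3-e) point reading `cX`):
Track B «K2-LIT», hLiu418 = stmt-HodgeConjecture-24832, road `K2_Liu`, socket #42S, organ S1 ROAD W, (G) organ (ρ-mid): THE NON-SPLIT READING AS A HAAR TRANSPORT.
-/
import Summits.HodgeConjecture.HodgeConjecture.Theorems.K2LiuLocalRingPlaceDecomposition    -- ★ (R4) `exists_addHaar_eq_smul_map`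
import Literature.NumberTheory.Automorphic.UnitaryGroupNonsplitPlace                         -- ★ `PlacesOver.subsingleton_of_smul_eq`
import Literature.NumberTheory.Automorphic.AdicCompletionLocalField                          -- ★ `E_w` locally compact (instances)
import Literature.NumberTheory.Automorphic.AdelicSecondCountable                             -- ★ `secondCountableTopology_adicCompletion`
import HarnessLib

/-!
# Crux `HLiu418`, #42S organ S1, (G) organ (ρ-mid): THE NON-SPLIT READING `x₁ ↦ ((β, γ), α)` AS AN ADDITIVE HOMEOMORPHISM AND ITS HAAR TRANSPORT
# (the `(e, c_e, hμ)` letter of ★ `K2LiuNonsplitMiddleProfileRow.factorisation_of_leviRow_reading`)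

Cell `hodgecm-mathlib`, crux item hLiu418 = `stmt-HodgeConjecture-24832`; squad K2 ∕ K2Liu; LEAD F0P6-plan (g14); (M2a) chain: ★ (C3) p862499 `K2LiuTensorMiddleCellLeviRow`
(K2Liu-p26), (C3-b) K2Liu-p23, (C3-c) K2E1-p10, (C3-d) K2Liu-p08, (C3-e) point reading K2Liu-p26; prover F0P2-p07 (g0) (non-split evaluation ★ p862456, phase 📤 p862514).
THEOREMS ONLY (no `def`, no instance, no notation, no named-fact hypothesis, no `sorry`); lane `--supports stmt-HodgeConjecture-24832 --as helper`.

WHY.  ★ p862456 `factorisation_of_leviRow_reading` takes the reading of the middle-cell integration variable `x₁ ∈ X₁ = F_v^{m}` as a measurable equivalence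
`e : X₁ ≃ (K × K) × K` (`K = E_{w₀}`, the ONE place above a non-split `v`) with the Haar transport `(μ × μ) × μ = c_e • e_*(⊗μ_v)`, `c_e ≠ 0`.  The (C3-e) point reading
(K2Liu-p26 (g2) 22:27:39Z) hands an `F_v`-linear bi-continuous `cX : X₁ ≃ (Fin 3 → E ⊗ F_v)` («row `i₀`» of the frame reading), and the (K1) row of the lattice-pair
reading mixes the triple by the frame matrix `P⁻¹` over `K`: `(α, β, γ) = ((cX x₁)(w₀)) ᵥ* P⁻¹`.  THIS FILE assembles `e` and its transport from those letters
(non-split twin of K2Liu-p08's 📤 `K2LiuSplitMiddleProfileTransport` §1–§2), generic quadratic `E/F`, `c`, non-split `w₀` (`c • w₀ = w₀`):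
* §1 `exists_homeomorph_eval` — at a non-split place `E ⊗ F_v ≃ₜ E_{w₀}`, `z ↦ z(w₀)` (one place above `v`, ★ `PlacesOver.subsingleton_of_smul_eq`); `exists_homeomorph_evalPi`
  (coordinatewise on `Fin n → ·`); `exists_homeomorph_vecMulK` (`u ↦ u ᵥ* Q` on `Fin n → K`, `Q` invertible); `exists_homeomorph_triple` (`Fin 3 → K ≃ₜ (K × K) × K`,
  `u ↦ ((u 1, u 2), u 0)` — ★ (M2b)'s order `((β, γ), α)`); all additive.
* §2 **`exists_reading_homeomorph`** — the composite `e : X₁ ≃ₜ (K × K) × K`, `e x₁ = ((u 1, u 2), u 0)` with `u = (fun l => ρ₀ x₁ l w₀) ᵥ* Q`, additive, for ANY additive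
  homeomorphism `ρ₀ : X₁ ≃ₜ (Fin 3 → E ⊗ F_v)` and invertible `Q` (consumer: `ρ₀ := cX`, `Q := P⁻¹`).
* §3 **`exists_reading_transport`** — ★ (R4): `∃ c_e > 0, (μ × μ) × μ = c_e • e_*(⊗ μ_v)` for that `e` (as `e.toMeasurableEquiv`), i.e. the `(e, ce, hce, hμ)` letters of
  ★ p862456 verbatim.
References: [CasselsFrohlichANT1967] Ch. II §10; [WeilBNT1967] Ch. II §5 Prop. 12; [Weil1965] §37; [Kudla1994] §3 Thm. 3.1.
HONEST LABEL.  Count-neutral helper; it retires nothing by itself: `HC_CM` is proved only modulo the 7 printed citations (2 remaining named inputs: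
hLiu418 = `stmt-HodgeConjecture-24832`, h413 = `stmt-HodgeConjecture-24833`) until rung 0 closes.

## References
* [CasselsFrohlichANT1967] J. W. S. Cassels, A. Fröhlich (eds.), *Algebraic Number Theory* (1967), Ch. II §10.
* [WeilBNT1967] A. Weil, *Basic Number Theory* (1967), Ch. II §5 Prop. 12.
* [Weil1965] A. Weil, *L'intégration dans les groupes topologiques* (2ᵉ éd. 1965), §37.
* [Kudla1994] S. S. Kudla, Israel J. Math. 87 (1994), §3 Thm. 3.1.
-/

set_option autoImplicit false
set_option linter.dupNamespace false -- the mandated namespace repeats `HodgeConjecture.HodgeConjecture`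

noncomputable section

open NumberField IsDedekindDomain MeasureTheory Matrix
open scoped ENNReal NNReal
open Literature.NumberTheory.Automorphic Literature.NumberTheory.Automorphic.UnitaryGroup
open Summit.HodgeConjecture.HodgeConjecture.Cruxes.HLiu418.K2LiuLocalRingPlaceDecomposition (exists_addHaar_eq_smul_map)

namespace Summit.HodgeConjecture.HodgeConjecture.Cruxes.HLiu418.K2LiuNonsplitMiddleProfileTransport

/-! ## §1 The four additive homeomorphisms -/

section Pieces

variable (F : Type) [Field F] [NumberField F] (E : Type) [Field E] [NumberField E] [Algebra F E] [Algebra.IsQuadraticExtension F E]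
  (c : E ≃ₐ[F] E) (hc : c ≠ 1) (v : HeightOneSpectrum (𝓞 F)) (w₀ : PlacesOver E v) (hw₀ : c • w₀.1 = w₀.1)

include hc hw₀ in
/-- **`E ⊗ F_v ≃ₜ E_{w₀}` AT A NON-SPLIT PLACE**, `z ↦ z(w₀)` (inverse `Pi.single w₀`; one place above `v`). [cite: CasselsFrohlichANT1967, Ch. II §10] -/
theorem exists_homeomorph_eval :
    ∃ r : LocalRing E v ≃ₜ w₀.1.adicCompletion E, (∀ z, r z = z w₀) ∧ ∀ z z', r (z + z') = r z + r z' := by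
  classical
  haveI : Subsingleton (PlacesOver E v) := PlacesOver.subsingleton_of_smul_eq c hc w₀ hw₀
  have hsingle : ∀ z : LocalRing E v, (Pi.single w₀ (z w₀) : LocalRing E v) = z := fun z => by
    funext w
    obtain rfl : w = w₀ := Subsingleton.elim w w₀
    rw [Pi.single_eq_same]
  let e : LocalRing E v ≃ w₀.1.adicCompletion E :=
    { toFun := fun z => z w₀, invFun := fun x => Pi.single w₀ x
      left_inv := fun z => hsingle z
      right_inv := fun x => by change (Pi.single w₀ x : LocalRing E v) w₀ = x; exact Pi.single_eq_same _ _ }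
  refine ⟨⟨e, continuous_apply w₀, ?_⟩, fun z => rfl, fun z z' => rfl⟩
  exact continuous_single (A := fun w : PlacesOver E v => w.1.adicCompletion E) w₀

include hc hw₀ in
/-- **coordinatewise: `(Fin n → E ⊗ F_v) ≃ₜ (Fin n → E_{w₀})`**, `u ↦ (l ↦ u l (w₀))`, additive. [cite: CasselsFrohlichANT1967, Ch. II §10] -/
theorem exists_homeomorph_evalPi (n : ℕ) :
    ∃ r : (Fin n → LocalRing E v) ≃ₜ (Fin n → w₀.1.adicCompletion E), (∀ u l, r u l = u l w₀) ∧ ∀ u u', r (u + u') = r u + r u' := by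
  obtain ⟨r₁, hr₁, hr₁add⟩ := exists_homeomorph_eval F E c hc v w₀ hw₀
  refine ⟨Homeomorph.piCongrRight fun _ => r₁, fun u l => hr₁ (u l), fun u u' => ?_⟩
  funext l
  simp only [Homeomorph.piCongrRight_apply, Pi.add_apply, hr₁add]

omit [NumberField F] [Algebra.IsQuadraticExtension F E] in
/-- **the frame change `u ↦ u ᵥ* Q` on `Fin n → E_{w₀}`** is an additive homeomorphism for `Q` invertible. [folklore] -/
theorem exists_homeomorph_vecMulK {n : ℕ} (Q : Matrix (Fin n) (Fin n) (w₀.1.adicCompletion E)) (hQ : IsUnit Q.det) :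
    ∃ φ : (Fin n → w₀.1.adicCompletion E) ≃ₜ (Fin n → w₀.1.adicCompletion E), (∀ u, φ u = u ᵥ* Q) ∧ ∀ u u', φ (u + u') = φ u + φ u' := by
  have hcQ : ∀ M : Matrix (Fin n) (Fin n) (w₀.1.adicCompletion E), Continuous fun u : Fin n → w₀.1.adicCompletion E => u ᵥ* M := fun M =>
    continuous_pi fun j => by
      simp only [Matrix.vecMul, dotProduct]
      exact continuous_finsetSum _ fun i _ => (continuous_apply i).mul continuous_const
  let e : (Fin n → w₀.1.adicCompletion E) ≃ (Fin n → w₀.1.adicCompletion E) :=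
    { toFun := fun u => u ᵥ* Q, invFun := fun u => u ᵥ* Q⁻¹
      left_inv := fun u => by simp only [Matrix.vecMul_vecMul, Matrix.mul_nonsing_inv _ hQ, Matrix.vecMul_one]
      right_inv := fun u => by simp only [Matrix.vecMul_vecMul, Matrix.nonsing_inv_mul _ hQ, Matrix.vecMul_one] }
  exact ⟨⟨e, hcQ Q, hcQ Q⁻¹⟩, fun u => rfl, fun u u' => Matrix.add_vecMul Q u u'⟩

omit [NumberField F] [Algebra.IsQuadraticExtension F E] in
/-- **`(Fin 3 → K) ≃ₜ (K × K) × K`, `u ↦ ((u 1, u 2), u 0)`** — ★ (M2b)'s integration order `((β, γ), α)` for the triple `(α, β, γ) = (u 0, u 1, u 2)`. [folklore] -/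
theorem exists_homeomorph_triple :
    ∃ r : (Fin 3 → w₀.1.adicCompletion E) ≃ₜ (w₀.1.adicCompletion E × w₀.1.adicCompletion E) × w₀.1.adicCompletion E,
      (∀ u, r u = ((u 1, u 2), u 0)) ∧ ∀ u u', r (u + u') = r u + r u' := by
  let e : (Fin 3 → w₀.1.adicCompletion E) ≃ (w₀.1.adicCompletion E × w₀.1.adicCompletion E) × w₀.1.adicCompletion E :=
    { toFun := fun u => ((u 1, u 2), u 0), invFun := fun p => ![p.2, p.1.1, p.1.2]
      left_inv := fun u => by
        funext l
        fin_cases l <;> rfl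
      right_inv := fun p => rfl }
  refine ⟨⟨e, ?_, ?_⟩, fun u => rfl, fun u u' => rfl⟩
  · exact (((continuous_apply 1).prodMk (continuous_apply 2)).prodMk (continuous_apply 0))
  · change Continuous fun p : (w₀.1.adicCompletion E × w₀.1.adicCompletion E) × w₀.1.adicCompletion E => (![p.2, p.1.1, p.1.2] : Fin 3 → w₀.1.adicCompletion E)
    refine continuous_pi fun l => ?_
    fin_cases l
    · exact continuous_snd
    · exact continuous_fst.comp continuous_fst
    · exact continuous_snd.comp continuous_fst

end Pieces

/-! ## §2 The composite reading -/

section Reading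

variable (F : Type) [Field F] [NumberField F] (E : Type) [Field E] [NumberField E] [Algebra F E] [Algebra.IsQuadraticExtension F E]
  (c : E ≃ₐ[F] E) (hc : c ≠ 1) (v : HeightOneSpectrum (𝓞 F)) (w₀ : PlacesOver E v) (hw₀ : c • w₀.1 = w₀.1)

include hc hw₀ in
/-- **THE NON-SPLIT READING `x₁ ↦ ((β, γ), α)` AS AN ADDITIVE HOMEOMORPHISM**: for an additive homeomorphism `ρ₀ : X ≃ₜ (Fin 3 → E ⊗ F_v)` (the (C3-e) point reading `cX`)
and an invertible `Q` over `E_{w₀}` (the frame mixing `P⁻¹` of the (K1) row), `e x = ((u 1, u 2), u 0)` with `u = (fun l => ρ₀ x l w₀) ᵥ* Q`.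
[cite: CasselsFrohlichANT1967, Ch. II §10] [cite: Kudla1994, §3 Thm. 3.1] -/
theorem exists_reading_homeomorph {X : Type*} [TopologicalSpace X] [Add X] (ρ₀ : X ≃ₜ (Fin 3 → LocalRing E v))
    (hρ₀ : ∀ x x', ρ₀ (x + x') = ρ₀ x + ρ₀ x') (Q : Matrix (Fin 3) (Fin 3) (w₀.1.adicCompletion E)) (hQ : IsUnit Q.det) :
    ∃ e : X ≃ₜ (w₀.1.adicCompletion E × w₀.1.adicCompletion E) × w₀.1.adicCompletion E,
      (∀ x, e x = ((((fun l => ρ₀ x l w₀) ᵥ* Q) 1, ((fun l => ρ₀ x l w₀) ᵥ* Q) 2), ((fun l => ρ₀ x l w₀) ᵥ* Q) 0)) ∧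
        ∀ x x', e (x + x') = e x + e x' := by
  obtain ⟨r₁, hr₁, hr₁add⟩ := exists_homeomorph_evalPi F E c hc v w₀ hw₀ 3
  obtain ⟨φ, hφ, hφadd⟩ := exists_homeomorph_vecMulK F E v w₀ Q hQ
  obtain ⟨r₃, hr₃, hr₃add⟩ := exists_homeomorph_triple F E v w₀
  refine ⟨((ρ₀.trans r₁).trans φ).trans r₃, fun x => ?_, fun x x' => ?_⟩
  · have hu : r₁ (ρ₀ x) = fun l => ρ₀ x l w₀ := funext fun l => hr₁ _ l
    simp only [Homeomorph.trans_apply, hr₃, hφ, hu]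
  · simp only [Homeomorph.trans_apply, hρ₀, hr₁add, hφadd, hr₃add]

end Reading

/-! ## §3 The Haar transport of the reading (★ (R4)) -/

section Transport

variable (F : Type) [Field F] [NumberField F] (E : Type) [Field E] [NumberField E] [Algebra F E] [Algebra.IsQuadraticExtension F E]
  (c : E ≃ₐ[F] E) (hc : c ≠ 1) (v : HeightOneSpectrum (𝓞 F)) (w₀ : PlacesOver E v) (hw₀ : c • w₀.1 = w₀.1)
  [MeasurableSpace (v.adicCompletion F)] [BorelSpace (v.adicCompletion F)] [SecondCountableTopology (v.adicCompletion F)]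
  (μv : Measure (v.adicCompletion F)) [μv.IsAddHaarMeasure]
  [MeasurableSpace (w₀.1.adicCompletion E)] [BorelSpace (w₀.1.adicCompletion E)] [SecondCountableTopology (w₀.1.adicCompletion E)]
  (μ : Measure (w₀.1.adicCompletion E)) [μ.IsAddHaarMeasure]

include hc hw₀ in
/-- **THE `(e, c_e, hμ)` LETTERS OF ★ `factorisation_of_leviRow_reading`**: for the (C3-e) point reading `ρ₀ : F_v^m ≃ₜ (Fin 3 → E ⊗ F_v)` (additive) and the frame mixing
`Q` (invertible), the reading `e` of §2 transports the product Haar measure: `∃ c_e > 0, (μ × μ) × μ = c_e • e_*(⊗_{Fin m} μ_v)` (★ (R4) `exists_addHaar_eq_smul_map`: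
both sides are Haar measures on `(K × K) × K`; the second-countability instances are ★ `secondCountableTopology_adicCompletion`, taken as instance binders so
that `e.toMeasurableEquiv` is well-typed in the statement). [cite: WeilBNT1967, Ch. II §5, Prop. 12] [cite: Weil1965, §37] -/
theorem exists_reading_transport {m : ℕ} (ρ₀ : (Fin m → v.adicCompletion F) ≃ₜ (Fin 3 → LocalRing E v))
    (hρ₀ : ∀ x x', ρ₀ (x + x') = ρ₀ x + ρ₀ x') (Q : Matrix (Fin 3) (Fin 3) (w₀.1.adicCompletion E)) (hQ : IsUnit Q.det) :
    ∃ (e : (Fin m → v.adicCompletion F) ≃ₜ (w₀.1.adicCompletion E × w₀.1.adicCompletion E) × w₀.1.adicCompletion E) (ce : ℝ≥0),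
      (∀ x, e x = ((((fun l => ρ₀ x l w₀) ᵥ* Q) 1, ((fun l => ρ₀ x l w₀) ᵥ* Q) 2), ((fun l => ρ₀ x l w₀) ᵥ* Q) 0)) ∧
      (∀ x x', e (x + x') = e x + e x') ∧ ce ≠ 0 ∧
      (μ.prod μ).prod μ = (ce : ℝ≥0∞) • Measure.map e.toMeasurableEquiv (Measure.pi fun _ : Fin m => μv) := by
  haveI : ((μ.prod μ).prod μ).IsAddHaarMeasure := Measure.prod.instIsAddHaarMeasure _ _
  obtain ⟨e, he, headd⟩ := exists_reading_homeomorph F E c hc v w₀ hw₀ ρ₀ hρ₀ Q hQ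
  obtain ⟨ce, hce, hμ⟩ := exists_addHaar_eq_smul_map e headd (Measure.pi fun _ : Fin m => μv) ((μ.prod μ).prod μ)
  exact ⟨e, ce, he, headd, hce.ne', hμ⟩

end Transport

end Summit.HodgeConjecture.HodgeConjecture.Cruxes.HLiu418.K2LiuNonsplitMiddleProfileTransport

end
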